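import Mathlib
import Literature.NumberTheory.LFunctions.ProlateUniqueness
import HarnessLib

/-!
# Shooting lemmas for the prolate equation (fixed parameter)

THIS IS NOT AN RH STATEMENT.  Generic facts about solutions `u` of the prolate differential equation

  `(λ² − x²) u″ − 2x u′ + (χ − (2πλx)²) u = 0`

with explicit first and second "derivative functions" `u₁, u₂` on a set `S` (structure
`IsProlateODESol`), used in the shooting construction of the prolate spheroidal wave functions:

* `IsProlateODESol.eq_zero_of_double_zero`: a double zero at a regular point forces `u ≡ 0` on
  `(−λ, λ)` (Cauchy uniqueness), hence `deriv_ne_zero_of_zero`: the zeros of a solution that is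
  regular and non-zero at `x = λ` are simple;
* `finite_zeros_of_deriv_ne_zero`: simple zeros in a compact interval are finite in number;
* `sign_near_left_of_zeros` and corollaries: the sign of `u` at the left end of `[c₀, c]` is
  `(−1)^m`, `m` = number of (simple) zeros in `(c₀, c)`, when `u(c) > 0`;
* `sturm_gap_pos_Icc`, `sturm_gap_Icc`, `exists_zero_in_gap_Icc`: Sturm's comparison step on a gap
  `[a, b] ⊆ [−λ, λ]` with hypotheses only on `[a, b]`;
* `IsProlateODESol.ncard_zeros_le`: for `χ < χ′` the solution with parameter `χ′` has at least as many
  zeros in `(0, λ)` as the one with parameter `χ` (both regular at `λ`), and at least one more if the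
  latter vanishes at `0` (Sturm's first comparison theorem, anchored at the singular point `λ`).

References: [Hartman 2002, Ch. XI §3]; [Coddington–Levinson 1955, Ch. 8 §§1–2];
[Slepian–Pollak 1961, §III].
-/

noncomputable section

open Real Set Filter Topology MeasureTheory intervalIntegral

namespace Literature.NumberTheory.LFunctions

/-! ### Solutions with explicit derivative functions -/

/-- `u` solves the prolate equation with parameter `χ` on the set `S`, with first derivative `u₁` and
second derivative `u₂` there: `(λ² − x²) u₂ − 2x u₁ + (χ − (2πλx)²) u = 0`.
[cite: SlepianPollak1961, §III eq. (11); ConnesConsaniMoscovici2025, §7 eq. (7.5)] -/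
structure IsProlateODESol (lam χ : ℝ) (S : Set ℝ) (u u₁ u₂ : ℝ → ℝ) : Prop where
  hasDerivAt : ∀ x ∈ S, HasDerivAt u (u₁ x) x
  hasDerivAt₁ : ∀ x ∈ S, HasDerivAt u₁ (u₂ x) x
  ode : ∀ x ∈ S, (lam ^ 2 - x ^ 2) * u₂ x - 2 * x * u₁ x + (χ - (2 * π * lam * x) ^ 2) * u x = 0

namespace IsProlateODESol

variable {lam χ : ℝ} {S : Set ℝ} {u u₁ u₂ : ℝ → ℝ}

/-- A solution is continuous on `S`. [folklore] -/
theorem continuousOn (h : IsProlateODESol lam χ S u u₁ u₂) : ContinuousOn u S :=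
  fun x hx ↦ (h.hasDerivAt x hx).continuousAt.continuousWithinAt

/-- The derivative function of a solution is continuous on `S`. [folklore] -/
theorem continuousOn₁ (h : IsProlateODESol lam χ S u u₁ u₂) : ContinuousOn u₁ S :=
  fun x hx ↦ (h.hasDerivAt₁ x hx).continuousAt.continuousWithinAt

/-- Restriction to a smaller set. [folklore] -/
theorem mono (h : IsProlateODESol lam χ S u u₁ u₂) {T : Set ℝ} (hT : T ⊆ S) :
    IsProlateODESol lam χ T u u₁ u₂ :=
  ⟨fun x hx ↦ h.hasDerivAt x (hT hx), fun x hx ↦ h.hasDerivAt₁ x (hT hx), fun x hx ↦ h.ode x (hT hx)⟩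

/-- `−u` is again a solution. [folklore] -/
theorem neg (h : IsProlateODESol lam χ S u u₁ u₂) :
    IsProlateODESol lam χ S (fun x ↦ -u x) (fun x ↦ -u₁ x) (fun x ↦ -u₂ x) := by
  refine ⟨fun x hx ↦ (h.hasDerivAt x hx).neg, fun x hx ↦ (h.hasDerivAt₁ x hx).neg, fun x hx ↦ ?_⟩
  linear_combination (-1 : ℝ) * h.ode x hx

/-- Constant multiples are solutions. [folklore] -/
theorem const_mul (h : IsProlateODESol lam χ S u u₁ u₂) (c : ℝ) :
    IsProlateODESol lam χ S (fun x ↦ c * u x) (fun x ↦ c * u₁ x) (fun x ↦ c * u₂ x) := by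
  refine ⟨fun x hx ↦ (h.hasDerivAt x hx).const_mul c, fun x hx ↦ (h.hasDerivAt₁ x hx).const_mul c,
    fun x hx ↦ ?_⟩
  linear_combination c * h.ode x hx

/-- The flux form of the equation: `((λ² − x²) u₁)′ = ((2πλx)² − χ) u`.
[cite: ConnesConsaniMoscovici2025, §7 eq. (7.5)] -/
theorem hasDerivAt_flux (h : IsProlateODESol lam χ S u u₁ u₂) {x : ℝ} (hx : x ∈ S) :
    HasDerivAt (fun y ↦ (lam ^ 2 - y ^ 2) * u₁ y) (((2 * π * lam * x) ^ 2 - χ) * u x) x := by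
  have hp : HasDerivAt (fun y : ℝ ↦ lam ^ 2 - y ^ 2) (-(2 * x)) x := by
    simpa using (hasDerivAt_pow 2 x).const_sub (lam ^ 2)
  refine (hp.mul (h.hasDerivAt₁ x hx)).congr_deriv ?_
  linear_combination h.ode x hx

/-- **Cauchy uniqueness at a regular point.**  A solution on `(−λ, λ)` with `u(x₀) = u′(x₀) = 0` at some
`x₀ ∈ (−λ, λ)` vanishes identically on `(−λ, λ)` (Picard–Lindelöf uniqueness for the phase system,
which is Lipschitz on every `[−μ, μ]`, `μ < λ`). [cite: CoddingtonLevinson1955, Ch. 1 §3 Thm 3.1] -/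
theorem eq_zero_of_double_zero (hlam : 0 < lam) (h : IsProlateODESol lam χ S u u₁ u₂)
    (hS : Ioo (-lam) lam ⊆ S) {x₀ : ℝ} (hx₀ : x₀ ∈ Ioo (-lam) lam) (h0 : u x₀ = 0)
    (h1 : u₁ x₀ = 0) : ∀ x ∈ Ioo (-lam) lam, u x = 0 := by
  intro x hx
  set μ : ℝ := (max |x| |x₀| + lam) / 2 with hμ
  have hxabs : |x| < lam := abs_lt.mpr ⟨hx.1, hx.2⟩
  have hx0abs : |x₀| < lam := abs_lt.mpr ⟨hx₀.1, hx₀.2⟩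
  have hmax : max |x| |x₀| < lam := max_lt hxabs hx0abs
  have hμlam : μ < lam := by rw [hμ]; linarith
  have hμpos : 0 < μ := by rw [hμ]; linarith [abs_nonneg x, le_max_left |x| |x₀|]
  have hxμ : x ∈ Ioo (-μ) μ := by
    have : |x| < μ := by rw [hμ]; linarith [le_max_left |x| |x₀|]
    exact ⟨by linarith [neg_abs_le x], lt_of_le_of_lt (le_abs_self x) this⟩
  have hx₀μ : x₀ ∈ Ioo (-μ) μ := by
    have : |x₀| < μ := by rw [hμ]; linarith [le_max_right |x| |x₀|]
    exact ⟨by linarith [neg_abs_le x₀], lt_of_le_of_lt (le_abs_self x₀) this⟩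
  have hsub : Ioo (-μ) μ ⊆ Ioo (-lam) lam := Ioo_subset_Ioo (by linarith) hμlam.le
  -- the vector field of the phase system `Y = (u, u′)`
  let v : ℝ → ℝ × ℝ → ℝ × ℝ := fun t Y ↦
    (Y.2, (2 * t * Y.2 + ((2 * π * lam * t) ^ 2 - χ) * Y.1) / (lam ^ 2 - t ^ 2))
  set L : ℝ := (2 * lam + ((2 * π * lam * lam) ^ 2 + |χ|)) / (lam ^ 2 - μ ^ 2) + 1 with hL
  have hden : 0 < lam ^ 2 - μ ^ 2 := by nlinarith
  have hLpos : 0 < L := by rw [hL]; positivity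
  have hv : ∀ t ∈ Ioo (-μ) μ, LipschitzOnWith (Real.toNNReal L) (v t) univ := by
    intro t ht
    have htabs : |t| < μ := abs_lt.mpr ⟨ht.1, ht.2⟩
    have hpt : lam ^ 2 - μ ^ 2 ≤ lam ^ 2 - t ^ 2 := by nlinarith [abs_nonneg t, sq_abs t]
    have hpt0 : 0 < lam ^ 2 - t ^ 2 := lt_of_lt_of_le hden hpt
    refine (LipschitzWith.of_dist_le_mul fun Y Z ↦ ?_).lipschitzOnWith
    rw [Real.coe_toNNReal _ hLpos.le]
    have hd1 : dist Y.1 Z.1 ≤ dist Y Z := by rw [Prod.dist_eq]; exact le_max_left _ _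
    have hd2 : dist Y.2 Z.2 ≤ dist Y Z := by rw [Prod.dist_eq]; exact le_max_right _ _
    rw [Real.dist_eq] at hd1 hd2
    have hdYZ : 0 ≤ dist Y Z := dist_nonneg
    rw [Prod.dist_eq]
    refine max_le ?_ ?_
    · rw [Real.dist_eq]
      calc |Y.2 - Z.2| ≤ dist Y Z := hd2
        _ = 1 * dist Y Z := (one_mul _).symm
        _ ≤ L * dist Y Z := by
            gcongr; rw [hL]
            linarith [show 0 ≤ (2 * lam + ((2 * π * lam * lam) ^ 2 + |χ|)) / (lam ^ 2 - μ ^ 2) by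
              positivity]
    · rw [Real.dist_eq, ← sub_div, abs_div, abs_of_pos hpt0]
      have hcoef1 : |2 * t| ≤ 2 * lam := by rw [abs_mul, abs_two]; linarith
      have hcoef2 : |(2 * π * lam * t) ^ 2 - χ| ≤ (2 * π * lam * lam) ^ 2 + |χ| := by
        refine (abs_sub _ _).trans (add_le_add ?_ le_rfl)
        rw [abs_pow, pow_le_pow_iff_left₀ (abs_nonneg _) (by positivity) two_ne_zero, abs_mul,
          abs_of_pos (by positivity : 0 < 2 * π * lam)]
        exact mul_le_mul_of_nonneg_left (by linarith) (by positivity)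
      have hnum : |2 * t * Y.2 + ((2 * π * lam * t) ^ 2 - χ) * Y.1
            - (2 * t * Z.2 + ((2 * π * lam * t) ^ 2 - χ) * Z.1)|
          ≤ (2 * lam + ((2 * π * lam * lam) ^ 2 + |χ|)) * dist Y Z := by
        have e : 2 * t * Y.2 + ((2 * π * lam * t) ^ 2 - χ) * Y.1
            - (2 * t * Z.2 + ((2 * π * lam * t) ^ 2 - χ) * Z.1)
            = 2 * t * (Y.2 - Z.2) + ((2 * π * lam * t) ^ 2 - χ) * (Y.1 - Z.1) := by ring
        rw [e]
        refine (abs_add_le _ _).trans ?_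
        rw [abs_mul (2 * t), abs_mul ((2 * π * lam * t) ^ 2 - χ), add_mul]
        exact add_le_add (mul_le_mul hcoef1 hd2 (abs_nonneg _) (by linarith))
          (mul_le_mul hcoef2 hd1 (abs_nonneg _) (by positivity))
      calc |2 * t * Y.2 + ((2 * π * lam * t) ^ 2 - χ) * Y.1
              - (2 * t * Z.2 + ((2 * π * lam * t) ^ 2 - χ) * Z.1)| / (lam ^ 2 - t ^ 2)
          ≤ (2 * lam + ((2 * π * lam * lam) ^ 2 + |χ|)) * dist Y Z / (lam ^ 2 - μ ^ 2) := by
            gcongr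
        _ = ((2 * lam + ((2 * π * lam * lam) ^ 2 + |χ|)) / (lam ^ 2 - μ ^ 2)) * dist Y Z := by
            ring
        _ ≤ L * dist Y Z := by gcongr; rw [hL]; linarith
  -- the two solutions: `(u, u₁)` and `0`
  have hYf : ∀ t ∈ Ioo (-μ) μ,
      HasDerivAt (fun s ↦ (u s, u₁ s)) (v t ((fun s ↦ (u s, u₁ s)) t)) t
        ∧ (fun s ↦ (u s, u₁ s)) t ∈ univ := by
    intro t ht
    have ht' := hsub ht
    have hpt0 : lam ^ 2 - t ^ 2 ≠ 0 := by
      have : |t| < lam := abs_lt.mpr ⟨ht'.1, ht'.2⟩; nlinarith [abs_nonneg t, sq_abs t]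
    refine ⟨?_, mem_univ _⟩
    have hh := (h.hasDerivAt t (hS ht')).prodMk (h.hasDerivAt₁ t (hS ht'))
    have hv' : (u₁ t, u₂ t) = v t ((fun s ↦ (u s, u₁ s)) t) := by
      simp only [v, Prod.mk.injEq, true_and]
      rw [eq_div_iff hpt0]
      linear_combination h.ode t (hS ht')
    exact hh.congr_deriv hv'
  have hYg : ∀ t ∈ Ioo (-μ) μ,
      HasDerivAt (fun _ : ℝ ↦ ((0 : ℝ), (0 : ℝ))) (v t ((fun _ : ℝ ↦ ((0 : ℝ), (0 : ℝ))) t)) t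
        ∧ (fun _ : ℝ ↦ ((0 : ℝ), (0 : ℝ))) t ∈ univ := by
    intro t _
    refine ⟨?_, mem_univ _⟩
    have hv0 : v t ((0 : ℝ), (0 : ℝ)) = 0 := by simp [v]
    have hc := hasDerivAt_const t ((0 : ℝ), (0 : ℝ))
    exact hc.congr_deriv hv0.symm
  have heq : (fun s ↦ (u s, u₁ s)) x₀ = (fun _ : ℝ ↦ ((0 : ℝ), (0 : ℝ))) x₀ := by simp [h0, h1]
  have hE := ODE_solution_unique_of_mem_Ioo hv hx₀μ hYf hYg heq hxμ
  have := congrArg Prod.fst hE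
  simpa using this

/-- **Zeros are simple** for a solution on `(−λ, λ)` that is continuous from inside at `λ` with
`u(λ) ≠ 0`: `u(x₀) = 0`, `x₀ ∈ (−λ, λ)` imply `u′(x₀) ≠ 0`.
[cite: CoddingtonLevinson1955, Ch. 8 §1] -/
theorem deriv_ne_zero_of_zero (hlam : 0 < lam) (h : IsProlateODESol lam χ S u u₁ u₂)
    (hS : Ioo (-lam) lam ⊆ S) (hcont : ContinuousWithinAt u (Ioo (-lam) lam) lam) (hl : u lam ≠ 0)
    {x₀ : ℝ} (hx₀ : x₀ ∈ Ioo (-lam) lam) (h0 : u x₀ = 0) : u₁ x₀ ≠ 0 := by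
  intro h1
  have hz := h.eq_zero_of_double_zero hlam hS hx₀ h0 h1
  haveI : (𝓝[Ioo (-lam) lam] lam).NeBot := right_nhdsWithin_Ioo_neBot (by linarith)
  have T1 : Tendsto u (𝓝[Ioo (-lam) lam] lam) (𝓝 (u lam)) := hcont.tendsto
  have T2 : Tendsto u (𝓝[Ioo (-lam) lam] lam) (𝓝 0) :=
    tendsto_const_nhds.congr' (by
      filter_upwards [self_mem_nhdsWithin] with x hx using (hz x hx).symm)
  exact hl (tendsto_nhds_unique T1 T2)

end IsProlateODESol

/-! ### Simple zeros in a compact interval are finite in number -/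

/-- If `u` is continuous on `[a, b]` and every zero of `u` in `[a, b]` is simple (`u` differentiable
there with non-zero derivative), then `u` has only finitely many zeros in `[a, b]` (an accumulation
point of zeros would be a zero with vanishing derivative). [folklore] -/
theorem finite_zeros_of_deriv_ne_zero {u u₁ : ℝ → ℝ} {a b : ℝ} (hcont : ContinuousOn u (Icc a b))
    (hd : ∀ x ∈ Icc a b, u x = 0 → HasDerivAt u (u₁ x) x ∧ u₁ x ≠ 0) :
    {x | x ∈ Icc a b ∧ u x = 0}.Finite := by
  by_contra hinf
  set Z := {x | x ∈ Icc a b ∧ u x = 0} with hZ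
  have hinf' : Z.Infinite := hinf
  let e := hinf'.natEmbedding Z
  let y : ℕ → ℝ := fun n ↦ (e n : ℝ)
  have hyZ : ∀ n, y n ∈ Z := fun n ↦ (e n).2
  have hyinj : Function.Injective y := fun m n hmn ↦ e.injective (Subtype.ext hmn)
  obtain ⟨p, hp, φ, hφ, hlim⟩ := isCompact_Icc.tendsto_subseq (x := y) (fun n ↦ (hyZ n).1)
  have hup : u p = 0 := by
    have T1 : Tendsto (u ∘ (y ∘ φ)) atTop (𝓝 (u p)) := by
      refine ((hcont p hp).tendsto).comp ?_
      exact tendsto_nhdsWithin_iff.mpr ⟨hlim, Eventually.of_forall fun n ↦ (hyZ (φ n)).1⟩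
    have T2 : Tendsto (u ∘ (y ∘ φ)) atTop (𝓝 0) :=
      tendsto_const_nhds.congr' (Eventually.of_forall fun n ↦ ((hyZ (φ n)).2).symm)
    exact tendsto_nhds_unique T1 T2
  obtain ⟨hdp, hne⟩ := hd p hp hup
  have hinj' : Function.Injective (y ∘ φ) := hyinj.comp hφ.injective
  have hev : ∀ᶠ n in atTop, (y ∘ φ) n ≠ p := by
    by_cases hex : ∃ n, (y ∘ φ) n = p
    · obtain ⟨n₀, hn₀⟩ := hex
      refine eventually_atTop.mpr ⟨n₀ + 1, fun n hn heq ↦ ?_⟩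
      have : n = n₀ := hinj' (heq.trans hn₀.symm)
      omega
    · push Not at hex
      exact Eventually.of_forall hex
  have hW : Tendsto (y ∘ φ) atTop (𝓝[≠] p) := tendsto_nhdsWithin_iff.mpr ⟨hlim, hev⟩
  have hslope : Tendsto (slope u p ∘ (y ∘ φ)) atTop (𝓝 (u₁ p)) :=
    (hasDerivAt_iff_tendsto_slope.mp hdp).comp hW
  have hzero : slope u p ∘ (y ∘ φ) = fun _ ↦ 0 := by
    funext n
    simp only [Function.comp_apply, slope_def_field, hup, (hyZ (φ n)).2, sub_self, zero_div]
  rw [hzero] at hslope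
  exact hne (tendsto_nhds_unique hslope tendsto_const_nhds)

/-! ### The sign of `u` near the left end in terms of the number of zeros -/

/-- **Sign count.**  Let `u` be continuous on `[c₀, c]` with `u(c) > 0` and exactly `m` zeros in
`(c₀, c)`, all simple.  Then `u` has the sign `(−1)^m` immediately to the right of `c₀`.
[folklore] -/
theorem sign_near_left_of_zeros : ∀ (m : ℕ) (u : ℝ → ℝ) (c₀ c : ℝ), c₀ < c →
    ContinuousOn u (Icc c₀ c) → {x | x ∈ Ioo c₀ c ∧ u x = 0}.Finite →
    {x | x ∈ Ioo c₀ c ∧ u x = 0}.ncard = m →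
    (∀ z ∈ Ioo c₀ c, u z = 0 → ∃ d ≠ 0, HasDerivAt u d z) → 0 < u c →
    ∃ c' ∈ Ioc c₀ c, ∀ x ∈ Ioo c₀ c', 0 < (-1) ^ m * u x := by
  -- no zeros on `(z, c)` and `u(c) > 0` force `u > 0` on `(z, c)`
  have aux : ∀ (u : ℝ → ℝ) (z c : ℝ), ContinuousOn u (Icc z c) → (∀ x ∈ Ioo z c, u x ≠ 0) →
      0 < u c → ∀ x ∈ Ioo z c, 0 < u x := by
    intro u z c hcont hne hc x hx
    rcases lt_trichotomy (u x) 0 with h | h | h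
    · exfalso
      have hsub : Icc x c ⊆ Icc z c := Icc_subset_Icc hx.1.le le_rfl
      have h0 : (0 : ℝ) ∈ Ioo (u x) (u c) := ⟨h, hc⟩
      obtain ⟨y, hy, huy⟩ := intermediate_value_Ioo hx.2.le (hcont.mono hsub) h0
      exact hne y ⟨lt_trans hx.1 hy.1, hy.2⟩ huy
    · exact absurd h (hne x hx)
    · exact h
  intro m
  induction m with
  | zero =>
    intro u c₀ c hc₀ hcont hfin hcard hder hc
    have hempty : {x | x ∈ Ioo c₀ c ∧ u x = 0} = ∅ := (Set.ncard_eq_zero hfin).mp hcard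
    have hne : ∀ x ∈ Ioo c₀ c, u x ≠ 0 := by
      intro x hx hux
      have : x ∈ ({x | x ∈ Ioo c₀ c ∧ u x = 0} : Set ℝ) := ⟨hx, hux⟩
      rw [hempty] at this
      exact this
    refine ⟨c, ⟨hc₀, le_rfl⟩, fun x hx ↦ ?_⟩
    rw [pow_zero, one_mul]
    exact aux u c₀ c hcont hne hc x hx
  | succ m ih =>
    intro u c₀ c hc₀ hcont hfin hcard hder hc
    set Z := {x | x ∈ Ioo c₀ c ∧ u x = 0} with hZ
    have hZne : Z.Nonempty := (Set.ncard_pos hfin).mp (by omega)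
    set z := sSup Z with hzdef
    have hz : z ∈ Z := hZne.csSup_mem hfin
    have hzmax : ∀ x ∈ Z, x ≤ z := fun x hx ↦ le_csSup hfin.bddAbove hx
    -- `u > 0` on `(z, c)`
    have hne : ∀ x ∈ Ioo z c, u x ≠ 0 := by
      intro x hx hux
      have := hzmax x ⟨⟨lt_trans hz.1.1 hx.1, hx.2⟩, hux⟩
      linarith [hx.1]
    have hzc : Icc z c ⊆ Icc c₀ c := Icc_subset_Icc hz.1.1.le le_rfl
    have hpos : ∀ x ∈ Ioo z c, 0 < u x := aux u z c (hcont.mono hzc) hne hc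
    -- the derivative at `z` is positive, so `u < 0` just left of `z`
    obtain ⟨d, hd0, hd⟩ := hder z hz.1 hz.2
    have hdpos : 0 < d :=
      lt_of_le_of_ne (hasDerivAt_nonneg_of_pos_right hd hz.2 hz.1.2 hpos) (Ne.symm hd0)
    have hslope : Tendsto (slope u z) (𝓝[<] z) (𝓝 d) :=
      (hasDerivAt_iff_tendsto_slope_left_right.mp hd).1
    have h1 : ∀ᶠ x in 𝓝[<] z, u x < 0 := by
      have hev := hslope.eventually (lt_mem_nhds hdpos)
      filter_upwards [hev, self_mem_nhdsWithin] with x hx hxz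
      rw [slope_def_field, hz.2, sub_zero] at hx
      have hxz' : x - z < 0 := sub_neg.mpr hxz
      have := mul_neg_of_pos_of_neg hx hxz'
      rwa [div_mul_cancel₀ _ hxz'.ne] at this
    have h2 : ∀ᶠ x in 𝓝[<] z, c₀ < x := by
      filter_upwards [Ioo_mem_nhdsLT hz.1.1] with x hx using hx.1
    have hZ'fin : (Z \ {z}).Finite := hfin.subset fun x hx ↦ hx.1
    have h3 : ∀ᶠ x in 𝓝[<] z, ∀ z' ∈ Z \ {z}, z' < x := by
      refine hZ'fin.eventually_all.mpr fun z' hz' ↦ ?_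
      have hlt : z' < z := lt_of_le_of_ne (hzmax z' hz'.1) (by simpa using hz'.2)
      filter_upwards [Ioo_mem_nhdsLT hlt] with x hx using hx.1
    have h4 : ∀ᶠ x in 𝓝[<] z, x < z := by
      filter_upwards [self_mem_nhdsWithin] with x hx using hx
    obtain ⟨c', hc'1, hc'2, hc'3, hc'4⟩ := (h1.and (h2.and (h3.and h4))).exists
    -- apply the induction hypothesis to `−u` on `[c₀, c']`
    have hc'c : c' < c := lt_trans hc'4 hz.1.2
    have hcont' : ContinuousOn (fun x ↦ -u x) (Icc c₀ c') :=
      (hcont.mono (Icc_subset_Icc le_rfl hc'c.le)).neg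
    have hZ' : {x | x ∈ Ioo c₀ c' ∧ -u x = 0} = Z \ {z} := by
      ext x
      simp only [mem_setOf_eq, neg_eq_zero, Set.mem_sdiff, mem_singleton_iff]
      constructor
      · rintro ⟨hx, hux⟩
        exact ⟨⟨⟨hx.1, lt_trans hx.2 hc'c⟩, hux⟩, by intro h; rw [h] at hx; linarith [hx.2]⟩
      · rintro ⟨hxZ, hxz⟩
        exact ⟨⟨hxZ.1.1, hc'3 x ⟨hxZ, hxz⟩⟩, hxZ.2⟩
    have hcard' : {x | x ∈ Ioo c₀ c' ∧ -u x = 0}.ncard = m := by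
      rw [hZ', Set.ncard_sdiff_singleton_of_mem hz, hcard]
      rfl
    have hfin' : {x | x ∈ Ioo c₀ c' ∧ -u x = 0}.Finite := by rw [hZ']; exact hZ'fin
    have hder' : ∀ z' ∈ Ioo c₀ c', -u z' = 0 → ∃ d ≠ 0, HasDerivAt (fun x ↦ -u x) d z' := by
      intro z' hz' huz'
      obtain ⟨d', hd'0, hd'⟩ := hder z' ⟨hz'.1, lt_trans hz'.2 hc'c⟩ (neg_eq_zero.mp huz')
      exact ⟨-d', neg_ne_zero.mpr hd'0, hd'.neg⟩
    obtain ⟨c'', hc'', hsign⟩ := ih (fun x ↦ -u x) c₀ c' hc'2 hcont' hfin' hcard' hder'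
      (by linarith)
    refine ⟨c'', ⟨hc''.1, hc''.2.trans hc'c.le⟩, fun x hx ↦ ?_⟩
    have := hsign x hx
    calc (0 : ℝ) < (-1) ^ m * -u x := this
      _ = (-1) ^ (m + 1) * u x := by ring

/-- The value at the left end has the sign `(−1)^m` (`m` simple zeros inside, `u(c) > 0`), if it is
non-zero. [folklore] -/
theorem pow_mul_pos_of_zeros {u : ℝ → ℝ} {m : ℕ} {c₀ c : ℝ} (hc₀ : c₀ < c)
    (hcont : ContinuousOn u (Icc c₀ c)) (hfin : {x | x ∈ Ioo c₀ c ∧ u x = 0}.Finite)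
    (hcard : {x | x ∈ Ioo c₀ c ∧ u x = 0}.ncard = m)
    (hder : ∀ z ∈ Ioo c₀ c, u z = 0 → ∃ d ≠ 0, HasDerivAt u d z) (hc : 0 < u c) (h0 : u c₀ ≠ 0) :
    0 < (-1) ^ m * u c₀ := by
  obtain ⟨c', hc', hsign⟩ := sign_near_left_of_zeros m u c₀ c hc₀ hcont hfin hcard hder hc
  haveI : (𝓝[Ioo c₀ c'] c₀).NeBot := left_nhdsWithin_Ioo_neBot hc'.1
  have hv : ContinuousWithinAt (fun x ↦ (-1) ^ m * u x) (Ioo c₀ c') c₀ :=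
    ((continuousWithinAt_const.mul (hcont.continuousWithinAt ⟨le_rfl, hc₀.le⟩))).mono
      (fun x hx ↦ ⟨hx.1.le, hx.2.le.trans hc'.2⟩)
  have hge : 0 ≤ (-1) ^ m * u c₀ :=
    ge_of_tendsto hv.tendsto (by
      filter_upwards [self_mem_nhdsWithin] with x hx using (hsign x hx).le)
  have hne : (-1) ^ m * u c₀ ≠ 0 := mul_ne_zero (pow_ne_zero _ (by norm_num)) h0
  exact lt_of_le_of_ne hge (Ne.symm hne)

/-- If the left end is itself a (simple) zero, the derivative there has the sign `(−1)^m`.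
[folklore] -/
theorem pow_mul_deriv_nonneg_of_zeros {u : ℝ → ℝ} {m : ℕ} {c₀ c d : ℝ} (hc₀ : c₀ < c)
    (hcont : ContinuousOn u (Icc c₀ c)) (hfin : {x | x ∈ Ioo c₀ c ∧ u x = 0}.Finite)
    (hcard : {x | x ∈ Ioo c₀ c ∧ u x = 0}.ncard = m)
    (hder : ∀ z ∈ Ioo c₀ c, u z = 0 → ∃ d ≠ 0, HasDerivAt u d z) (hc : 0 < u c) (h0 : u c₀ = 0)
    (hd : HasDerivAt u d c₀) : 0 ≤ (-1) ^ m * d := by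
  obtain ⟨c', hc', hsign⟩ := sign_near_left_of_zeros m u c₀ c hc₀ hcont hfin hcard hder hc
  have hd' : HasDerivAt (fun x ↦ (-1) ^ m * u x) ((-1) ^ m * d) c₀ := hd.const_mul _
  exact hasDerivAt_nonneg_of_pos_right hd' (by simp [h0]) hc'.1 hsign

/-! ### Sturm's comparison step on a gap `[a, b] ⊆ [−λ, λ]` -/

/-- **Sturm's comparison step**, local form: as `sturm_gap_pos` but with all hypotheses on `[a, b]`
only (`f′ = f₁` on `[a, b]`, fluxes differentiable on `(a, b)`).
[cite: Hartman2002, Ch. XI §3 Thm 3.1; CoddingtonLevinson1955, Ch. 8 §1 Thm 1.1] -/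
theorem sturm_gap_pos_Icc {lam χf χg a b : ℝ} {f g f₁ g₁ : ℝ → ℝ} (hχ : χf < χg)
    (hfc : ContinuousOn f (Icc a b)) (hgc : ContinuousOn g (Icc a b))
    (hf₁c : ContinuousOn f₁ (Icc a b)) (hg₁c : ContinuousOn g₁ (Icc a b))
    (hfd : ∀ x ∈ Icc a b, HasDerivAt f (f₁ x) x)
    (hgd : ∀ x ∈ Ioo a b, HasDerivAt g (g₁ x) x)
    (hfe : ∀ x ∈ Ioo a b,
      HasDerivAt (fun y ↦ (lam ^ 2 - y ^ 2) * f₁ y) (((2 * π * lam * x) ^ 2 - χf) * f x) x)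
    (hge : ∀ x ∈ Ioo a b,
      HasDerivAt (fun y ↦ (lam ^ 2 - y ^ 2) * g₁ y) (((2 * π * lam * x) ^ 2 - χg) * g x) x)
    (ha : -lam ≤ a) (hab : a < b) (hb : b ≤ lam)
    (hfa : a = -lam ∨ f a = 0) (hfb : b = lam ∨ f b = 0)
    (hfpos : ∀ x ∈ Ioo a b, 0 < f x) (hgpos : ∀ x ∈ Ioo a b, 0 < g x) : False := by
  set W : ℝ → ℝ := fun x ↦ f x * ((lam ^ 2 - x ^ 2) * g₁ x) - (lam ^ 2 - x ^ 2) * f₁ x * g x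
    with hW
  have hWd : ∀ x ∈ Ioo a b, HasDerivAt W ((χf - χg) * f x * g x) x := by
    intro x hx
    have h1 : HasDerivAt (fun y ↦ f y * ((lam ^ 2 - y ^ 2) * g₁ y))
        (f₁ x * ((lam ^ 2 - x ^ 2) * g₁ x) + f x * (((2 * π * lam * x) ^ 2 - χg) * g x)) x :=
      (hfd x (Ioo_subset_Icc_self hx)).mul (hge x hx)
    have h2 : HasDerivAt (fun y ↦ (lam ^ 2 - y ^ 2) * f₁ y * g y)
        (((2 * π * lam * x) ^ 2 - χf) * f x * g x + (lam ^ 2 - x ^ 2) * f₁ x * g₁ x) x :=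
      (hfe x hx).mul (hgd x hx)
    exact (h1.sub h2).congr_deriv (by ring)
  have hp : Continuous fun x : ℝ ↦ lam ^ 2 - x ^ 2 := by fun_prop
  have hWc : ContinuousOn W (Icc a b) :=
    (hfc.mul (hp.continuousOn.mul hg₁c)).sub ((hp.continuousOn.mul hf₁c).mul hgc)
  have hprod : ContinuousOn (fun x ↦ f x * g x) (Icc a b) := hfc.mul hgc
  have hint : IntervalIntegrable (fun x ↦ (χf - χg) * f x * g x) volume a b := by
    apply ContinuousOn.intervalIntegrable
    rw [uIcc_of_le hab.le]
    exact (continuousOn_const.mul hfc).mul hgc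
  have hftc : ∫ x in a..b, (χf - χg) * f x * g x = W b - W a :=
    integral_eq_sub_of_hasDerivAt_of_le hab.le hWc hWd hint
  have hneg : ∫ x in a..b, (χf - χg) * f x * g x < 0 := by
    have hpos : 0 < ∫ x in a..b, (χg - χf) * (f x * g x) := by
      apply intervalIntegral_pos_of_pos_on
      · apply ContinuousOn.intervalIntegrable
        rw [uIcc_of_le hab.le]
        exact continuousOn_const.mul hprod
      · intro x hx
        exact mul_pos (sub_pos.mpr hχ) (mul_pos (hfpos x hx) (hgpos x hx))
      · exact hab
    have : ∫ x in a..b, (χf - χg) * f x * g x = -∫ x in a..b, (χg - χf) * (f x * g x) := by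
      rw [← intervalIntegral.integral_neg]
      congr 1; ext x; ring
    linarith
  have hga : 0 ≤ g a := by
    haveI : (𝓝[Ioo a b] a).NeBot := left_nhdsWithin_Ioo_neBot hab
    have ht : Tendsto g (𝓝[Ioo a b] a) (𝓝 (g a)) :=
      ((hgc.continuousWithinAt ⟨le_rfl, hab.le⟩).mono Ioo_subset_Icc_self).tendsto
    exact ge_of_tendsto ht (by
      filter_upwards [self_mem_nhdsWithin] with x hx using (hgpos x hx).le)
  have hgb : 0 ≤ g b := by
    haveI : (𝓝[Ioo a b] b).NeBot := right_nhdsWithin_Ioo_neBot hab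
    have ht : Tendsto g (𝓝[Ioo a b] b) (𝓝 (g b)) :=
      ((hgc.continuousWithinAt ⟨hab.le, le_rfl⟩).mono Ioo_subset_Icc_self).tendsto
    exact ge_of_tendsto ht (by
      filter_upwards [self_mem_nhdsWithin] with x hx using (hgpos x hx).le)
  have hWa : W a ≤ 0 := by
    rcases hfa with hal | hfa0
    · have : lam ^ 2 - a ^ 2 = 0 := by rw [hal]; ring
      simp only [hW, this, zero_mul, mul_zero, sub_self, le_refl]
    · have hf₁a : 0 ≤ f₁ a :=
        hasDerivAt_nonneg_of_pos_right (hfd a ⟨le_rfl, hab.le⟩) hfa0 hab hfpos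
      have hpa : 0 ≤ lam ^ 2 - a ^ 2 := by nlinarith
      have : W a = -((lam ^ 2 - a ^ 2) * f₁ a * g a) := by simp only [hW, hfa0, zero_mul, zero_sub]
      rw [this, neg_nonpos]
      exact mul_nonneg (mul_nonneg hpa hf₁a) hga
  have hWb : 0 ≤ W b := by
    rcases hfb with hbl | hfb0
    · have : lam ^ 2 - b ^ 2 = 0 := by rw [hbl]; ring
      simp only [hW, this, zero_mul, mul_zero, sub_self, le_refl]
    · have hf₁b : f₁ b ≤ 0 :=
        hasDerivAt_nonpos_of_pos_left (hfd b ⟨hab.le, le_rfl⟩) hfb0 hab hfpos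
      have hpb : 0 ≤ lam ^ 2 - b ^ 2 := by nlinarith
      have : W b = -((lam ^ 2 - b ^ 2) * f₁ b * g b) := by simp only [hW, hfb0, zero_mul, zero_sub]
      rw [this, neg_nonneg]
      have : (lam ^ 2 - b ^ 2) * f₁ b ≤ 0 := mul_nonpos_of_nonneg_of_nonpos hpb hf₁b
      exact mul_nonpos_of_nonpos_of_nonneg this hgb
  linarith

/-- Sturm's comparison step, local form, for functions of constant signs on the gap.
[cite: Hartman2002, Ch. XI §3 Thm 3.1; CoddingtonLevinson1955, Ch. 8 §1 Thm 1.1] -/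
theorem sturm_gap_Icc {lam χf χg a b : ℝ} {f g f₁ g₁ : ℝ → ℝ} (hχ : χf < χg)
    (hfc : ContinuousOn f (Icc a b)) (hgc : ContinuousOn g (Icc a b))
    (hf₁c : ContinuousOn f₁ (Icc a b)) (hg₁c : ContinuousOn g₁ (Icc a b))
    (hfd : ∀ x ∈ Icc a b, HasDerivAt f (f₁ x) x)
    (hgd : ∀ x ∈ Ioo a b, HasDerivAt g (g₁ x) x)
    (hfe : ∀ x ∈ Ioo a b,
      HasDerivAt (fun y ↦ (lam ^ 2 - y ^ 2) * f₁ y) (((2 * π * lam * x) ^ 2 - χf) * f x) x)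
    (hge : ∀ x ∈ Ioo a b,
      HasDerivAt (fun y ↦ (lam ^ 2 - y ^ 2) * g₁ y) (((2 * π * lam * x) ^ 2 - χg) * g x) x)
    (ha : -lam ≤ a) (hab : a < b) (hb : b ≤ lam)
    (hfa : a = -lam ∨ f a = 0) (hfb : b = lam ∨ f b = 0)
    (hfs : (∀ x ∈ Ioo a b, 0 < f x) ∨ (∀ x ∈ Ioo a b, f x < 0))
    (hgs : (∀ x ∈ Ioo a b, 0 < g x) ∨ (∀ x ∈ Ioo a b, g x < 0)) : False := by
  have negd : ∀ {u u₁ : ℝ → ℝ} {T : Set ℝ}, (∀ x ∈ T, HasDerivAt u (u₁ x) x) →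
      (∀ x ∈ T, HasDerivAt (fun y ↦ -u y) ((fun y ↦ -u₁ y) x) x) :=
    fun hu x hx ↦ (hu x hx).neg
  have nege : ∀ {u u₁ : ℝ → ℝ} {χ : ℝ},
      (∀ x ∈ Ioo a b,
        HasDerivAt (fun y ↦ (lam ^ 2 - y ^ 2) * u₁ y) (((2 * π * lam * x) ^ 2 - χ) * u x) x) →
      (∀ x ∈ Ioo a b,
        HasDerivAt (fun y ↦ (lam ^ 2 - y ^ 2) * (fun y ↦ -u₁ y) y)
          (((2 * π * lam * x) ^ 2 - χ) * (fun y ↦ -u y) x) x) := by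
    intro u u₁ χ hue x hx
    have h := (hue x hx).neg
    refine (h.congr_of_eventuallyEq (Eventually.of_forall fun y ↦ ?_)).congr_deriv ?_
    · simp only [mul_neg, Pi.neg_apply]
    · ring
  have hfan : ∀ {u : ℝ → ℝ}, (a = -lam ∨ u a = 0) → (a = -lam ∨ (fun y ↦ -u y) a = 0) := by
    intro u h; rcases h with h | h
    · exact Or.inl h
    · exact Or.inr (by simp [h])
  have hfbn : ∀ {u : ℝ → ℝ}, (b = lam ∨ u b = 0) → (b = lam ∨ (fun y ↦ -u y) b = 0) := by
    intro u h; rcases h with h | h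
    · exact Or.inl h
    · exact Or.inr (by simp [h])
  rcases hfs with hfp | hfn <;> rcases hgs with hgp | hgn
  · exact sturm_gap_pos_Icc hχ hfc hgc hf₁c hg₁c hfd hgd hfe hge ha hab hb hfa hfb hfp hgp
  · exact sturm_gap_pos_Icc hχ hfc hgc.neg hf₁c hg₁c.neg hfd (negd hgd) hfe (nege hge) ha hab hb
      hfa hfb hfp (fun x hx ↦ by simpa using hgn x hx)
  · exact sturm_gap_pos_Icc hχ hfc.neg hgc hf₁c.neg hg₁c (negd hfd) hgd (nege hfe) hge ha hab hb
      (hfan hfa) (hfbn hfb) (fun x hx ↦ by simpa using hfn x hx) hgp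
  · exact sturm_gap_pos_Icc hχ hfc.neg hgc.neg hf₁c.neg hg₁c.neg (negd hfd) (negd hgd) (nege hfe)
      (nege hge) ha hab hb (hfan hfa) (hfbn hfb) (fun x hx ↦ by simpa using hfn x hx)
      (fun x hx ↦ by simpa using hgn x hx)

/-- Sturm's comparison step as an existence statement: a gap of `f` (no zeros inside, ends zeros of
`f` or singular end points) contains a zero of the more oscillatory `g`.
[cite: Hartman2002, Ch. XI §3 Thm 3.1; CoddingtonLevinson1955, Ch. 8 §1 Thm 1.1] -/
theorem exists_zero_in_gap_Icc {lam χf χg a b : ℝ} {f g f₁ g₁ : ℝ → ℝ} (hχ : χf < χg)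
    (hfc : ContinuousOn f (Icc a b)) (hgc : ContinuousOn g (Icc a b))
    (hf₁c : ContinuousOn f₁ (Icc a b)) (hg₁c : ContinuousOn g₁ (Icc a b))
    (hfd : ∀ x ∈ Icc a b, HasDerivAt f (f₁ x) x)
    (hgd : ∀ x ∈ Ioo a b, HasDerivAt g (g₁ x) x)
    (hfe : ∀ x ∈ Ioo a b,
      HasDerivAt (fun y ↦ (lam ^ 2 - y ^ 2) * f₁ y) (((2 * π * lam * x) ^ 2 - χf) * f x) x)
    (hge : ∀ x ∈ Ioo a b,
      HasDerivAt (fun y ↦ (lam ^ 2 - y ^ 2) * g₁ y) (((2 * π * lam * x) ^ 2 - χg) * g x) x)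
    (ha : -lam ≤ a) (hab : a < b) (hb : b ≤ lam)
    (hfa : a = -lam ∨ f a = 0) (hfb : b = lam ∨ f b = 0) (hfz : ∀ x ∈ Ioo a b, f x ≠ 0) :
    ∃ z ∈ Ioo a b, g z = 0 := by
  by_contra hcon
  push Not at hcon
  have hfs := pos_or_neg_of_ne_zero hab (hfc.mono Ioo_subset_Icc_self) hfz
  have hgs := pos_or_neg_of_ne_zero hab (hgc.mono Ioo_subset_Icc_self) hcon
  exact sturm_gap_Icc hχ hfc hgc hf₁c hg₁c hfd hgd hfe hge ha hab hb hfa hfb hfs hgs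

/-! ### Monotonicity of the zero count on `(0, λ)` in the parameter -/

namespace IsProlateODESol

variable {lam χ χ' : ℝ} {S T : Set ℝ} {u u₁ u₂ v v₁ v₂ : ℝ → ℝ}

/-- **Sturm's first comparison theorem, anchored at the singular point `λ`.**  If `E ⊆ [0, λ)` is a
finite set of zeros of the solution `u` (parameter `χ`), then the solution `v` with the larger
parameter `χ′ > χ` has at least `#E` zeros in `(0, λ)`: one in each gap of `u` to the right of a
point of `E`. [cite: Hartman2002, Ch. XI §3 Cor 3.1; CoddingtonLevinson1955, Ch. 8 §1 Thm 1.2] -/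
theorem ncard_le_ncard_zeros (hlam : 0 < lam) (hu : IsProlateODESol lam χ S u u₁ u₂)
    (hv : IsProlateODESol lam χ' T v v₁ v₂) (hS : Icc 0 lam ⊆ S) (hT : Icc 0 lam ⊆ T) (hχ : χ < χ')
    (hZu : {x | x ∈ Ioo 0 lam ∧ u x = 0}.Finite) (hZv : {x | x ∈ Ioo 0 lam ∧ v x = 0}.Finite)
    {E : Set ℝ} (hE : ∀ e ∈ E, e ∈ Ico 0 lam ∧ u e = 0) :
    E.ncard ≤ {x | x ∈ Ioo 0 lam ∧ v x = 0}.ncard := by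
  set Zu : Set ℝ := {x | x ∈ Ioo 0 lam ∧ u x = 0} with hZu'
  set Zv : Set ℝ := {x | x ∈ Ioo 0 lam ∧ v x = 0} with hZv'
  -- the right end of the gap starting at `e`
  set R : ℝ → Set ℝ := fun e ↦ {z | z ∈ Zu ∧ e < z} ∪ {lam} with hR
  have hRf : ∀ e, (R e).Finite := fun e ↦ (hZu.subset (fun z hz ↦ hz.1)).union (finite_singleton _)
  have hRn : ∀ e, (R e).Nonempty := fun e ↦ ⟨lam, Or.inr rfl⟩
  set nxt : ℝ → ℝ := fun e ↦ sInf (R e) with hnxt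
  have hnxt_mem : ∀ e, nxt e ∈ R e := fun e ↦ (hRn e).csInf_mem (hRf e)
  have hnxt_le : ∀ e, ∀ z ∈ R e, nxt e ≤ z := fun e z hz ↦ csInf_le (hRf e).bddBelow hz
  have hnxt_gt : ∀ e ∈ E, e < nxt e := by
    intro e he
    rcases hnxt_mem e with h | h
    · exact h.2
    · rw [h]; exact (hE e he).1.2
  have hnxt_lam : ∀ e, nxt e ≤ lam := fun e ↦ hnxt_le e lam (Or.inr rfl)
  have hnxt_end : ∀ e, nxt e = lam ∨ u (nxt e) = 0 := by
    intro e
    rcases hnxt_mem e with h | h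
    · exact Or.inr h.1.2
    · exact Or.inl h
  have hgap : ∀ e ∈ E, ∀ x ∈ Ioo e (nxt e), u x ≠ 0 := by
    intro e he x hx hux
    have hxZ : x ∈ Zu := ⟨⟨by linarith [(hE e he).1.1, hx.1], by linarith [hnxt_lam e, hx.2]⟩, hux⟩
    have := hnxt_le e x (Or.inl ⟨hxZ, hx.1⟩)
    linarith [hx.2]
  -- a zero of `v` in each gap
  have hex : ∀ e ∈ E, ∃ z ∈ Ioo e (nxt e), v z = 0 := by
    intro e he
    have he0 := (hE e he).1.1
    have hsub : Icc e (nxt e) ⊆ Icc 0 lam := Icc_subset_Icc he0 (hnxt_lam e)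
    have hsubo : Ioo e (nxt e) ⊆ Icc 0 lam := Ioo_subset_Icc_self.trans hsub
    exact exists_zero_in_gap_Icc hχ ((hu.continuousOn).mono (hsub.trans hS))
      ((hv.continuousOn).mono (hsub.trans hT)) ((hu.continuousOn₁).mono (hsub.trans hS))
      ((hv.continuousOn₁).mono (hsub.trans hT)) (fun x hx ↦ hu.hasDerivAt x (hS (hsub hx)))
      (fun x hx ↦ hv.hasDerivAt x (hT (hsubo hx))) (fun x hx ↦ hu.hasDerivAt_flux (hS (hsubo hx)))
      (fun x hx ↦ hv.hasDerivAt_flux (hT (hsubo hx))) (by linarith) (hnxt_gt e he) (hnxt_lam e)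
      (Or.inr (hE e he).2) (hnxt_end e) (hgap e he)
  choose! z hz using hex
  have hzZv : ∀ e ∈ E, z e ∈ Zv := by
    intro e he
    obtain ⟨hze, hvz⟩ := hz e he
    exact ⟨⟨by linarith [(hE e he).1.1, hze.1], by linarith [hnxt_lam e, hze.2]⟩, hvz⟩
  have hmono : ∀ e₁ ∈ E, ∀ e₂ ∈ E, e₁ < e₂ → z e₁ < z e₂ := by
    intro e₁ he₁ e₂ he₂ hlt'
    have hn : nxt e₁ ≤ e₂ := by
      rcases (hE e₂ he₂).1.1.eq_or_lt with h | h
      · exfalso; linarith [(hE e₁ he₁).1.1]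
      · exact hnxt_le e₁ e₂ (Or.inl ⟨⟨⟨h, (hE e₂ he₂).1.2⟩, (hE e₂ he₂).2⟩, hlt'⟩)
    linarith [(hz e₁ he₁).1.2, (hz e₂ he₂).1.1]
  have hinj : InjOn z E := by
    intro e₁ he₁ e₂ he₂ heq
    by_contra hne
    rcases lt_or_gt_of_ne hne with h | h
    · exact absurd heq (hmono e₁ he₁ e₂ he₂ h).ne
    · exact absurd heq (hmono e₂ he₂ e₁ he₁ h).ne'
  exact ncard_le_ncard_of_injOn z hzZv hinj hZv

/-- The zero count on `(0, λ)` is monotone in the parameter (both solutions regular at `λ`).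
[cite: Hartman2002, Ch. XI §3 Cor 3.1] -/
theorem ncard_zeros_mono (hlam : 0 < lam) (hu : IsProlateODESol lam χ S u u₁ u₂)
    (hv : IsProlateODESol lam χ' T v v₁ v₂) (hS : Icc 0 lam ⊆ S) (hT : Icc 0 lam ⊆ T) (hχ : χ < χ')
    (hZu : {x | x ∈ Ioo 0 lam ∧ u x = 0}.Finite) (hZv : {x | x ∈ Ioo 0 lam ∧ v x = 0}.Finite) :
    {x | x ∈ Ioo 0 lam ∧ u x = 0}.ncard ≤ {x | x ∈ Ioo 0 lam ∧ v x = 0}.ncard :=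
  hu.ncard_le_ncard_zeros hlam hv hS hT hχ hZu hZv fun _ he ↦ ⟨⟨he.1.1.le, he.1.2⟩, he.2⟩

/-- If moreover `u(0) = 0`, the count increases strictly. [cite: Hartman2002, Ch. XI §3 Cor 3.1] -/
theorem ncard_zeros_lt (hlam : 0 < lam) (hu : IsProlateODESol lam χ S u u₁ u₂)
    (hv : IsProlateODESol lam χ' T v v₁ v₂) (hS : Icc 0 lam ⊆ S) (hT : Icc 0 lam ⊆ T) (hχ : χ < χ')
    (hZu : {x | x ∈ Ioo 0 lam ∧ u x = 0}.Finite) (hZv : {x | x ∈ Ioo 0 lam ∧ v x = 0}.Finite)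
    (h0 : u 0 = 0) :
    {x | x ∈ Ioo 0 lam ∧ u x = 0}.ncard + 1 ≤ {x | x ∈ Ioo 0 lam ∧ v x = 0}.ncard := by
  have h0n : (0 : ℝ) ∉ {x | x ∈ Ioo 0 lam ∧ u x = 0} := fun h ↦ lt_irrefl _ h.1.1
  have hE : ∀ e ∈ insert (0 : ℝ) {x | x ∈ Ioo 0 lam ∧ u x = 0}, e ∈ Ico 0 lam ∧ u e = 0 := by
    intro e he
    rcases he with rfl | he
    · exact ⟨⟨le_rfl, hlam⟩, h0⟩
    · exact ⟨⟨he.1.1.le, he.1.2⟩, he.2⟩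
  have := hu.ncard_le_ncard_zeros hlam hv hS hT hχ hZu hZv hE
  rwa [ncard_insert_of_notMem h0n hZu] at this

end IsProlateODESol

end Literature.NumberTheory.LFunctions
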